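import Literature.Geometry.Riemannian.ChenZhuConformalPic
import Literature.Geometry.Riemannian.ConformalIsotropicCurvature
import Literature.Geometry.Riemannian.SchrodingerClosedManifold
import HarnessLib

/-!
# Proof of the named fact `chenZhu_conformalPic_of_isotropicFormPos`
# (Chen–Zhu 2014, Cor. 2.2 with §3 ¶1 = Gursky–LeBrun 1998, Prop. 3, dimension four)

This file DISCHARGES `Literature.Geometry.Riemannian.chenZhu_conformalPic_of_isotropicFormPos`
(`ChenZhuConformalPic.lean`): on a closed smooth `4`-manifold with a smooth Riemannian `G`, if
for some `c > 0` and a continuous lower bound `μ` of the isotropic curvatures of `G`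
(`μ(x) ≤ K(e)` on every `G_x`-orthonormal `4`-frame) the isotropic Yamabe form dominates `L²`,
`c ∫ u² dV_G ≤ ∫ (6|∇u|²_G + 3μu²) dV_G` for all `u ∈ C¹(M)`, then there is a smooth `u > 0` such
that `u² G` is a Riemannian metric of positive isotropic curvature.

Proof (the printed one, Chen–Zhu 2014, §2–§3 / Gursky–LeBrun 1998, Prop. 3: "`𝒴_f > 0` ⇒ the
first eigenvalue of the modified conformal Laplacian is positive ⇒ a positive eigen/super-solution
`u` ⇒ `σ_{u²g} = u⁻³(σ_g u − 6Δu) > 0` ⇒ PIC", with the eigenfunction replaced by a positive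
strict supersolution, which is all the conclusion needs):

1. *Analysis* (`SchrodingerClosedManifold.lean`, `exists_pos_smooth_supersolution_of_coercive`):
   the hypothesis says that the form of `−Δ_G + μ/2` is coercive with constant `c/6`, so there is
   a smooth `u > 0` with `−Δ_G u + (μ/2) u > 0`, i.e. `2Δ_G u < μ u` (Lax–Milgram on the closed
   manifold, elliptic regularity via Folland's Cor. (6.34) — proved in this tree —, nonnegativity
   by truncation and positivity by E. Hopf's minimum principle).
2. *Geometry* (`ConformalIsotropicCurvature.lean`,
   `isotropicCurvature_conformal_sq_four_of_isOrthonormalFrame`; Besse 1987, 1.159 (b),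
   Micallef–Wang 1993, §2, Chen–Zhu 2014, (2.8) at `n = 4`): for `G' = u²G`, every Levi-Civita
   connection of `G'`, every point `x` and every `G'_x`-orthonormal frame `e'`,
   `K'(e') = u⁻² K(u e') − 2u⁻³ Δ_G u = u⁻³ (u K(ue') − 2Δ_G u)`, and `ue'` is `G`-orthonormal, so
   `K(ue') ≥ μ(x)` and `K'(e') ≥ u⁻³(μu − 2Δ_G u) > 0`.
3. The conformal metric `x ↦ u(x)² G_x` is a smooth symmetric nondegenerate section
   (`ContMDiff.smul_section`), Riemannian since `u² > 0`.

No definition and no statement of `Prop` type is introduced; the fact's only dependent, the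
route item `ConformalPic` of `SmoothPoincare4/IsotropicCorkBracketing`
(`chenZhu_pic_of_isotropicFormPos`), becomes unconditional by
`chenZhu_pic_of_isotropicFormPos chenZhu_conformalPic_of_isotropicFormPos_holds`.

## References

* B.-L. Chen, X.-P. Zhu, *A conformally invariant classification theorem in four dimensions*,
  Comm. Anal. Geom. 22 (2014) 811–831 (arXiv:1206.5051), §2 (2.8), Cor. 2.2; §3, proof of
  Thm. 1.1, first paragraph. [ChenZhu2014]
* M. J. Gursky, C. LeBrun, *Yamabe invariants and spinᶜ structures*, GAFA 8 (1998) 965–977,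
  Prop. 3. [GurskyLebrun1998]
* M. Micallef, M. Wang, Duke Math. J. 72 (1993) 649–672, §2. [MicallefWang1993]
* R. S. Hamilton, Comm. Anal. Geom. 5 (1997) 1–92, §1.2. [Hamilton1997]
-/

noncomputable section

open Bundle MeasureTheory Module Function
open scoped Manifold ContDiff Topology

namespace Literature.Geometry.Riemannian

open Lorentzian Lorentzian.PseudoRiemannianMetric

/-- **Chen–Zhu 2014, Cor. 2.2 with §3 ¶1 (= Gursky–LeBrun 1998, Prop. 3) holds in the typed
form of `chenZhu_conformalPic_of_isotropicFormPos`**: a positive isotropic Yamabe form on a closed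
`4`-manifold yields a smooth positive `u` with `u²G` Riemannian of positive isotropic curvature.
Assembly of `exists_pos_smooth_supersolution_of_coercive` (a smooth `u > 0` with `2Δ_G u < μu`,
from the `L²`-coercivity of `∫(6|∇u|² + 3μu²)`) with the conformal law of the isotropic
curvature `K'(e') = u⁻³(uK(ue') − 2Δ_Gu)` (`isotropicCurvature_conformal_sq_four_of_isOrthonormalFrame`)
and the lower bound `μ ≤ K(ue')` on the `G`-orthonormal frame `ue'`.
[cite: ChenZhu2014, Cor. 2.2 and §3 (first paragraph)] [cite: GurskyLebrun1998, Prop. 3] -/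
theorem chenZhu_conformalPic_of_isotropicFormPos_holds :
    chenZhu_conformalPic_of_isotropicFormPos := by
  classical
  intro M _ _ _ _ _ _ _ _ G hG _ hyp
  obtain ⟨c, hc, μ, hμc, hμK, hcoer⟩ := hyp
  set h := G.toContMDiffRiemannianMetric hG with hh
  haveI hLC : (ofRiemannian h).HasLeviCivita := ‹G.HasLeviCivita›
  set ν : Measure M := riemannianMeasure h with hν
  -- the coercivity of `−Δ + μ/2` with constant `c/6`
  have hcoer' : ∀ w : M → ℝ, ContMDiff (𝓡 4) 𝓘(ℝ, ℝ) 1 w →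
      c / 6 * ∫ x, w x ^ 2 ∂ν ≤ ∫ x, ((ofRiemannian h).gradSq w x + μ x / 2 * w x ^ 2) ∂ν := by
    intro w hw
    have h1 := hcoer w hw
    have heq : ∫ x, (6 * G.gradSq w x + 3 * μ x * w x ^ 2) ∂ν =
        6 * ∫ x, ((ofRiemannian h).gradSq w x + μ x / 2 * w x ^ 2) ∂ν := by
      rw [← integral_const_mul]
      refine integral_congr_ae (Filter.Eventually.of_forall fun x ↦ ?_)
      change 6 * (ofRiemannian h).gradSq w x + 3 * μ x * w x ^ 2 = _
      ring
    rw [heq] at h1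
    linarith
  -- a smooth positive `u` with `2 Δ_G u < μ u` (positive strict supersolution of `−Δ + μ/2`)
  obtain ⟨u, hu, hupos, hsuper⟩ := exists_pos_smooth_supersolution_of_coercive h
    (by norm_num : 0 < 4) (hμc.div_const 2) (by positivity : 0 < c / 6) hcoer'
  have hsuper' : ∀ x, 2 * G.dalembertian u x < μ x * u x := fun x ↦ by
    have h1 := hsuper x
    change 0 < -G.dalembertian u x + μ x / 2 * u x at h1
    linarith
  -- the conformal metric `G' = u² G`
  have h2s : ContMDiff (𝓡 4) 𝓘(ℝ) ∞ (fun x ↦ u x ^ 2) := (contDiff_id.pow 2).comp_contMDiff hu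
  haveI : ∀ x : M, ContinuousAdd (TangentSpace (𝓡 4) x →L[ℝ] ℝ) := fun x ↦ inferInstance
  haveI : ∀ x : M, IsTopologicalAddGroup (TangentSpace (𝓡 4) x →L[ℝ] TangentSpace (𝓡 4) x →L[ℝ] ℝ) :=
    fun x ↦ inferInstance
  haveI : ∀ x : M, ContinuousSMul ℝ (TangentSpace (𝓡 4) x →L[ℝ] TangentSpace (𝓡 4) x →L[ℝ] ℝ) :=
    fun x ↦ inferInstance
  have hsm := h2s.smul_section G.contMDiff
  have hsymm : ∀ (x : M) (v w : TangentSpace (𝓡 4) x),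
      ((u x ^ 2) • G.val x) v w = ((u x ^ 2) • G.val x) w v := fun x v w ↦ by
    change u x ^ 2 * G.val x v w = u x ^ 2 * G.val x w v
    rw [G.symm x v w]
  have hnd : ∀ (x : M) (v : TangentSpace (𝓡 4) x),
      (∀ w, ((u x ^ 2) • G.val x) v w = 0) → v = 0 :=
    fun x v hv ↦ G.nondegenerate x v fun w ↦ by
      have h1 : u x ^ 2 * G.val x v w = 0 := hv w
      exact (mul_eq_zero.1 h1).resolve_left (pow_ne_zero 2 (hupos x).ne')
  obtain ⟨G', hgg'⟩ : ∃ G' : PseudoRiemannianMetric (𝓡 4) ∞ (EuclideanSpace ℝ (Fin 4))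
      (TangentSpace (𝓡 4) : M → Type _),
      ∀ (x : M) (v w : TangentSpace (𝓡 4) x), G'.val x v w = u x ^ 2 * G.val x v w :=
    ⟨⟨fun x ↦ (u x ^ 2) • G.val x, hsymm, hnd, hsm⟩, fun x v w ↦ rfl⟩
  refine ⟨u, hu, hupos, G', hgg', fun x v hv ↦ ?_, ?_⟩
  · -- Riemannian
    rw [hgg']
    exact mul_pos (pow_pos (hupos x) 2) (hG x v hv)
  · -- positive isotropic curvature, for every Levi-Civita connection of `G'`
    intro cov hcov x e he
    haveI : G'.HasLeviCivita := G'.hasLeviCivita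
    have hE : finrank ℝ (EuclideanSpace ℝ (Fin 4)) = 4 := finrank_euclideanSpace_fin
    rw [isotropicCurvature_conformal_sq_four_of_isOrthonormalFrame hE G G' hu hupos hgg' hcov x he]
    have hframe : G.IsOrthonormalFrame x (fun i ↦ u x • e i) :=
      IsOrthonormalFrame.smul_of_conformal G (hgg' x) he
    have hK := hμK x _ hframe
    have hux := hupos x
    have hrew : (u x ^ 2)⁻¹ * G.isotropicCurvature G.leviCivita x (fun i ↦ u x • e i)
        - 2 * (u x ^ 3)⁻¹ * G.dalembertian u x =
        (u x ^ 3)⁻¹ * (u x * G.isotropicCurvature G.leviCivita x (fun i ↦ u x • e i)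
          - 2 * G.dalembertian u x) := by
      field_simp
    rw [hrew]
    refine mul_pos (inv_pos.2 (pow_pos hux 3)) ?_
    nlinarith [hsuper' x, mul_le_mul_of_nonneg_left hK hux.le]

end Literature.Geometry.Riemannian
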